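import Summits.QuantumFields.YangMills.Theorems.BalabanUVNodesN11FibrewiseOfWeakIdentity

/-!
# DAG node N11 — THE FROZEN-`y` SECTIONS OF def-T's SKEW CONDITIONAL EXPECTATION ARE THE FIBRE TRANSPORTS; (hce) ⟺ (hfib) — generic half and record letters

HEADER — WORK-UNIT METADATA.  Cell `pub-ymgap`, YM-PLAN Track A (HUMAN RULING D-0062), seat `pub-ymgap-dag-n11-e` (g23; R134 fan-out seat N11 [B14], strategy s3), route
`BalabanUVNodes`, item K1⁹ `StabilityBRunRowsAtRecordR13SepCoPHV` = stmt-QuantumFields-27364 (helper lane, `--kind proof --supports 27364 --as helper`, count-neutral).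
[I] = [Balaban1987RG1], [III] = [Balaban1988Convergent].  FILE 2 of 3, over FILE 1 `…N11FibrewiseOfWeakIdentity` (the converse Fubini reduction), node00-def-T's
`T4AveragingDisintegration` (`kernelTransport`, `integral_kernelTransport_mul`, `integrable_kernelTransport`, `ae_eq_of_forall_integral_mul_eq`), this seat's g21
`Node00/AveragingSkewPresentation` (p612977: the glue `e = piEquivPiSubtypeProd.symm`, `measurable_avOfRecord_glue_rest`, `centralBond_mem_bondsIn_iff`, the one-variable law
`map_haar_avOfRecord_update_centralBond_absolutelyContinuous`) and `T4TriangularPushforward.map_pi_absolutelyContinuous_pi`.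

WHY THIS FILE.  With FILE 1 the three displayed forms (hce₀) ∕ (hweak) ∕ (hfib) of the per-old-branch identity of the (O3′) clause are equivalent; THIS FILE pins the
candidate: along a first-coordinate-preserving map `(y,u) ↦ (y, φ(y,u))` between products `μy ⊗ ν → μy ⊗ μ₂`, def-T's disintegration transport of `ρ`, READ AT FROZEN `y`, IS —
for `μy`-a.e. `y`, `μ₂`-a.e. in `v` — the disintegration transport of the fibre density `ρ(y,·)` along the fibre map `φ(y,·)` (★★★ `ae_kernelTransport_skew_section_ae_eq_fibre`).
So (hfib) holds with the TRUE candidate (the fibre transports), and (hce) for a candidate `R` says exactly «`R(y,·)` is the fibre transport of `ρ(y,·)`, a.e.».  At the record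
(§2) the fibre map is `u ↦ (Ū(e(y,u))(c))_{c ∉ sV'}` on `⊗_{b ∉ sV} dU(b)` and the structural input is FIBRE absolute continuity for EVERY frozen `y` (★ §2, the triangular
push-forward theorem in the private coordinates `β(c) = centralBond c ∉ sV`) — the frozen-`y` strengthening of p612977's joint `hac_in`.  On each fibre the transport is a def-T
`kernelTransport` of a fine density along an averaging-type map: the currency in which `Node00/TransportOfRecordGaugeFixing*` (p618524 ∕ p620090 ∕ p622555) rewrite the integrand.

WHAT THIS FILE PROVES (0 `def`, 0 `sorry`, standard axioms).
§1 (generic; `Y`, `U`, `V` standard Borel, finite measures): `map_skew_absolutelyContinuous_of_fibre` (fibre AC a.e. ⇒ joint AC of the skew map) · `weak_kernelTransport_skew` (the skew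
   transport satisfies (hweak) with itself as candidate) · ★★★ `ae_kernelTransport_skew_section_ae_eq_fibre` · ★★ `ae_fibreTransport_congr_of_skew_ae_eq` (a.e.-equal skew
   transports ⇒ a.e.-equal fibre transports on a.e. fibre) · ★★ `fibrewise_of_condExp` ((hce) ⇒ (hfib): the converse of dag-n11-d's
   `condExp_identity_of_fibrewise`) · ★★ `condExp_iff_fibrewise` · ★★ `condExp_iff_fibrewise_of_nonneg`.
§2 (record letters `K k`, ANY finite `sV`, `sV'`, ANY `dU`-integrable `ρ`): ★ `map_pi_avOfRecord_glue_fibre_absolutelyContinuous` (fibre AC for EVERY frozen `y`, under `Y` saturated,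
   `sV ⊆ B_k(Y)`, `B_{k+1}(Y) ⊆ sV'`) · ★★★ `ae_condExp_section_ae_eq_fibreTransport_at_record` · ★★★ `fibrewise_of_condExp_at_record` (joint AC displayed) · ★★★
   `condExp_iff_fibrewise_at_record`; private glue∕update plumbing.

HONEST FRAMING.  Helper lane of K1⁹; count-neutral; [folklore] measure theory over def-T's DEFINITIONS and the tree's averaging; no chart, no Jacobian, nothing of Bałaban's
([I] §2, [III] Thm 2 ∕ (3.10)–(3.25)) asserted — the identity (hfib)/(hce₀) with the supplier's `R̃` stays DISPLAYED in dag-n11-d's theorems; (O3′) NOT closed; N11 NOT discharged;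
K1⁹ NOT closed, no registered stub touched; counts unmoved (typed 28∕28 · discharged 5∕27 · A 5∕28).  One finite `𝕋⁴_{L^K}` programme at fixed `ε = L^{−K}`; R4 closes only the
conditional finite-𝕋⁴ rung `BalabanLadder.UV` — NOT ℝ⁴, NOT OS, NOT a mass gap, NOT Clay.  No `sorry`, `axiom`, `def`, `instance`, `notation`.
Sources (SHAPE ∕ bookkeeping only): [III] (2.21) p.258, (3.1) p.264, (3.10)–(3.11) p.266, (3.12)–(3.14) p.267, (3.23)–(3.25) p.270; [I] (0.4) p.253, §2 p.267.
-/

noncomputable section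

open MeasureTheory ProbabilityTheory
open scoped ENNReal NNReal BigOperators

namespace Summit.QuantumFields.YangMills.Theorems.BalabanUVNodesN11CondExpFibreSections

open Literature.MathematicalPhysics.QuantumFieldTheory.Balaban1983to89
open Literature.MathematicalPhysics.QuantumFieldTheory.Balaban1983to89.T4AveragingDisintegration
open BalabanUVNodesN11CondExpOfFibrewiseIdentity (weak_of_fibrewise weak_of_fibrewise_of_nonneg integrable_candidate_of_fibrewise)
open BalabanUVNodesN11FibrewiseOfWeakIdentity (fibrewise_of_weak fibrewise_of_weak_of_nonneg)

/-! ## §1  Generic: the skew conditional expectation, section by section -/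

section Generic

variable {Y U V : Type*} [MeasurableSpace Y] [MeasurableSpace U] [MeasurableSpace V]

/-- **FIBRE ABSOLUTE CONTINUITY ⇒ JOINT ABSOLUTE CONTINUITY OF THE SKEW MAP**: if for `μy`-a.e. `y` the fibre map `u ↦ φ(y,u)` pushes `ν` to a measure `≪ μ₂`, then
`(y,u) ↦ (y, φ(y,u))` pushes `μy ⊗ ν` to a measure `≪ μy ⊗ μ₂` (a null set of the target has `μ₂`-null slices over `μy`-a.e. `y`). [folklore] -/
theorem map_skew_absolutelyContinuous_of_fibre (μy : Measure Y) [SFinite μy] (ν : Measure U) [SFinite ν] (μ₂ : Measure V) [SFinite μ₂]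
    {φ : Y × U → V} (hφ : Measurable φ) (hac : ∀ᵐ y ∂μy, ν.map (fun u => φ (y, u)) ≪ μ₂) :
    (μy.prod ν).map (fun q : Y × U => (q.1, φ q)) ≪ μy.prod μ₂ := by
  have hsk : Measurable (fun q : Y × U => (q.1, φ q)) := measurable_fst.prodMk hφ
  refine Measure.AbsolutelyContinuous.mk fun s hs hs0 => ?_
  rw [Measure.map_apply hsk hs, Measure.prod_apply (hsk hs)]
  rw [Measure.prod_apply hs] at hs0
  have h0 : ∀ᵐ y ∂μy, μ₂ (Prod.mk y ⁻¹' s) = 0 := (lintegral_eq_zero_iff (measurable_measure_prodMk_left hs)).1 hs0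
  refine (lintegral_congr_ae ((hac.and h0).mono fun y hy => ?_)).trans lintegral_zero
  obtain ⟨hy, hy0⟩ := hy
  have hφy : Measurable fun u => φ (y, u) := hφ.comp measurable_prodMk_left
  show ν (Prod.mk y ⁻¹' ((fun q : Y × U => (q.1, φ q)) ⁻¹' s)) = 0
  have h1 : Prod.mk y ⁻¹' ((fun q : Y × U => (q.1, φ q)) ⁻¹' s) = (fun u => φ (y, u)) ⁻¹' (Prod.mk y ⁻¹' s) := rfl
  rw [h1, ← Measure.map_apply hφy (measurable_prodMk_left hs)]
  exact hy hy0

variable [StandardBorelSpace Y] [StandardBorelSpace U] [Nonempty Y] [Nonempty U]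

/-- **def-T's SKEW TRANSPORT SATISFIES THE WEAK IDENTITY WITH ITSELF AS CANDIDATE** (the push-forward identity `integral_kernelTransport_mul` along the skew map; the weak
identity is therefore inhabited by the true conditional expectation). [cite: Balaban1988Convergent, (3.1) p.264, (2.21) p.258 (bookkeeping)] -/
theorem weak_kernelTransport_skew (μy : Measure Y) [IsFiniteMeasure μy] (ν : Measure U) [IsFiniteMeasure ν] (μ₂ : Measure V) [SigmaFinite μ₂]
    {ρ : Y × U → ℝ} (hρ : Integrable ρ (μy.prod ν)) {φ : Y × U → V} (hφ : Measurable φ)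
    (hac : (μy.prod ν).map (fun q : Y × U => (q.1, φ q)) ≪ μy.prod μ₂)
    (f : Y × V → ℝ) (hf : Measurable f) (hC : ∃ C : ℝ, ∀ z, |f z| ≤ C) :
    ∫ q, ρ q * f (q.1, φ q) ∂(μy.prod ν) =
      ∫ z, kernelTransport (μy.prod ν) (μy.prod μ₂) (fun q : Y × U => (q.1, φ q)) ρ z * f z ∂(μy.prod μ₂) := by
  obtain ⟨C, hC⟩ := hC
  exact (integral_kernelTransport_mul _ _ (measurable_fst.prodMk hφ) hac hρ hf hC).symm

/-- ★★★ **THE FROZEN-`y` SECTIONS OF THE SKEW CONDITIONAL EXPECTATION ARE THE FIBRE TRANSPORTS.**  For finite measures `μy`, `ν`, `μ₂` (standard Borel carriers), `ρ` integrable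
w.r.t. `μy ⊗ ν`, `φ` jointly measurable with every fibre map `u ↦ φ(y,u)` pushing `ν` to a measure `≪ μ₂`:
for `μy`-a.e. `y`,  `(v ↦ kernelTransport (μy⊗ν) (μy⊗μ₂) ((y,u) ↦ (y, φ(y,u))) ρ (y, v)) =ᵐ[μ₂] kernelTransport ν μ₂ (φ(y,·)) (ρ(y,·))`
— def-T's disintegration transport along the skew map, read at frozen retained variable `y`, IS the disintegration transport of the fibre density along the fibre map
(`fibrewise_of_weak` applied to the true candidate, then a.e. uniqueness on the fibre against the fibre push-forward identity).
[cite: Balaban1988Convergent, (3.1) p.264, (3.10)–(3.14) pp.266–267, (3.23)–(3.25) p.270 (SHAPE: the retained variables frozen); Balaban1987RG1, (0.4) p.253] -/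
theorem ae_kernelTransport_skew_section_ae_eq_fibre [StandardBorelSpace V] (μy : Measure Y) [IsFiniteMeasure μy] (ν : Measure U) [IsFiniteMeasure ν]
    (μ₂ : Measure V) [IsFiniteMeasure μ₂]
    {ρ : Y × U → ℝ} (hρ : Integrable ρ (μy.prod ν)) {φ : Y × U → V} (hφ : Measurable φ)
    (hac : ∀ y, ν.map (fun u => φ (y, u)) ≪ μ₂) :
    ∀ᵐ y ∂μy, (fun v => kernelTransport (μy.prod ν) (μy.prod μ₂) (fun q : Y × U => (q.1, φ q)) ρ (y, v)) =ᵐ[μ₂]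
      kernelTransport ν μ₂ (fun u => φ (y, u)) (fun u => ρ (y, u)) := by
  have hsk : Measurable (fun q : Y × U => (q.1, φ q)) := measurable_fst.prodMk hφ
  have hacj := map_skew_absolutelyContinuous_of_fibre μy ν μ₂ hφ (ae_of_all _ hac)
  have hT : Integrable (kernelTransport (μy.prod ν) (μy.prod μ₂) (fun q : Y × U => (q.1, φ q)) ρ) (μy.prod μ₂) :=
    integrable_kernelTransport _ _ hsk hacj hρ
  have hfib := fibrewise_of_weak μy ν μ₂ hρ hφ hT (weak_kernelTransport_skew μy ν μ₂ hρ hφ hacj)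
  filter_upwards [hfib, hρ.prod_right_ae, hT.prod_right_ae] with y hy hρy hTy
  have hφy : Measurable fun u => φ (y, u) := hφ.comp measurable_prodMk_left
  refine ae_eq_of_forall_integral_mul_eq hTy (integrable_kernelTransport _ _ hφy (hac y) hρy) fun h hh hC => ?_
  obtain ⟨C, hC⟩ := hC
  calc ∫ v, kernelTransport (μy.prod ν) (μy.prod μ₂) (fun q : Y × U => (q.1, φ q)) ρ (y, v) * h v ∂μ₂
      = ∫ u, ρ (y, u) * h (φ (y, u)) ∂ν := (hy h hh ⟨C, hC⟩).symm
    _ = ∫ v, kernelTransport ν μ₂ (fun u => φ (y, u)) (fun u => ρ (y, u)) v * h v ∂μ₂ :=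
        (integral_kernelTransport_mul _ _ hφy (hac y) hρy hh hC).symm

/-- ★★ **A.E.-EQUAL SKEW TRANSPORTS HAVE A.E.-EQUAL FIBRE TRANSPORTS ON A.E. FIBRE**: if the skew conditional expectations of `ρ₁` and `ρ₂` agree `μy ⊗ μ₂`-a.e. (e.g. by a
gauge-fixing law rewriting the integrand under the transport), then for `μy`-a.e. `y` the fibre transports of `ρ₁(y,·)` and `ρ₂(y,·)` along `φ(y,·)` agree `μ₂`-a.e. (slices of a
null set + ★★★). [cite: Balaban1988Convergent, (3.1) p.264, p.265 L.10–12 (SHAPE); Balaban1987RG1, (0.4) p.253] -/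
theorem ae_fibreTransport_congr_of_skew_ae_eq [StandardBorelSpace V] (μy : Measure Y) [IsFiniteMeasure μy] (ν : Measure U) [IsFiniteMeasure ν] (μ₂ : Measure V)
    [IsFiniteMeasure μ₂] {ρ₁ ρ₂ : Y × U → ℝ} (hρ₁ : Integrable ρ₁ (μy.prod ν)) (hρ₂ : Integrable ρ₂ (μy.prod ν)) {φ : Y × U → V} (hφ : Measurable φ)
    (hac : ∀ y, ν.map (fun u => φ (y, u)) ≪ μ₂)
    (h : kernelTransport (μy.prod ν) (μy.prod μ₂) (fun q : Y × U => (q.1, φ q)) ρ₁ =ᵐ[μy.prod μ₂]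
      kernelTransport (μy.prod ν) (μy.prod μ₂) (fun q : Y × U => (q.1, φ q)) ρ₂) :
    ∀ᵐ y ∂μy, kernelTransport ν μ₂ (fun u => φ (y, u)) (fun u => ρ₁ (y, u)) =ᵐ[μ₂] kernelTransport ν μ₂ (fun u => φ (y, u)) (fun u => ρ₂ (y, u)) := by
  filter_upwards [Measure.ae_ae_of_ae_prod h, ae_kernelTransport_skew_section_ae_eq_fibre μy ν μ₂ hρ₁ hφ hac,
    ae_kernelTransport_skew_section_ae_eq_fibre μy ν μ₂ hρ₂ hφ hac] with y hy h₁ h₂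
  exact (h₁.symm.trans hy).trans h₂

/-- ★★ **(hce) ⟹ (hfib): THE CONVERSE OF dag-n11-d's `condExp_identity_of_fibrewise`.**  If the skew conditional expectation of `ρ` IS `R` a.e., then the frozen-`y` fibrewise
identity holds with candidate `R` (push-forward identity ⇒ (hweak) ⇒ `fibrewise_of_weak`).  Joint absolute continuity of the skew map is the only structural input.
[cite: Balaban1988Convergent, (3.1) p.264, (2.21) p.258, (3.23)–(3.25) p.270 (SHAPE); Balaban1987RG1, (0.4) p.253] -/
theorem fibrewise_of_condExp [StandardBorelSpace V] (μy : Measure Y) [IsFiniteMeasure μy] (ν : Measure U) [IsFiniteMeasure ν] (μ₂ : Measure V) [IsFiniteMeasure μ₂]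
    {ρ : Y × U → ℝ} (hρ : Integrable ρ (μy.prod ν)) {φ : Y × U → V} (hφ : Measurable φ)
    (hac : (μy.prod ν).map (fun q : Y × U => (q.1, φ q)) ≪ μy.prod μ₂) {R : Y × V → ℝ}
    (hce : kernelTransport (μy.prod ν) (μy.prod μ₂) (fun q : Y × U => (q.1, φ q)) ρ =ᵐ[μy.prod μ₂] R) :
    ∀ᵐ y ∂μy, ∀ h : V → ℝ, Measurable h → (∃ C : ℝ, ∀ v, |h v| ≤ C) →
      ∫ u, ρ (y, u) * h (φ (y, u)) ∂ν = ∫ v, R (y, v) * h v ∂μ₂ := by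
  have hsk : Measurable (fun q : Y × U => (q.1, φ q)) := measurable_fst.prodMk hφ
  have hT : Integrable (kernelTransport (μy.prod ν) (μy.prod μ₂) (fun q : Y × U => (q.1, φ q)) ρ) (μy.prod μ₂) :=
    integrable_kernelTransport _ _ hsk hac hρ
  refine fibrewise_of_weak μy ν μ₂ hρ hφ (hT.congr hce) fun f hf hC => ?_
  rw [weak_kernelTransport_skew μy ν μ₂ hρ hφ hac f hf hC]
  exact integral_congr_ae (hce.mono fun z hz => by dsimp only; rw [hz])

/-- ★★ **(hce) ⟺ (hfib)**, candidate integrable: def-T's skew conditional expectation of `ρ` is `R` a.e. IFF the frozen-`y` fibrewise identity holds with candidate `R`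
(backward = dag-n11-d's road `weak_of_fibrewise` + a.e. uniqueness of the transform). [cite: Balaban1988Convergent, (3.1) p.264, (2.21) p.258 (SHAPE); Balaban1987RG1, (0.4) p.253] -/
theorem condExp_iff_fibrewise [StandardBorelSpace V] (μy : Measure Y) [IsFiniteMeasure μy] (ν : Measure U) [IsFiniteMeasure ν] (μ₂ : Measure V) [IsFiniteMeasure μ₂]
    {ρ : Y × U → ℝ} (hρ : Integrable ρ (μy.prod ν)) {φ : Y × U → V} (hφ : Measurable φ)
    (hac : (μy.prod ν).map (fun q : Y × U => (q.1, φ q)) ≪ μy.prod μ₂) {R : Y × V → ℝ} (hRint : Integrable R (μy.prod μ₂)) :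
    kernelTransport (μy.prod ν) (μy.prod μ₂) (fun q : Y × U => (q.1, φ q)) ρ =ᵐ[μy.prod μ₂] R ↔
    ∀ᵐ y ∂μy, ∀ h : V → ℝ, Measurable h → (∃ C : ℝ, ∀ v, |h v| ≤ C) →
      ∫ u, ρ (y, u) * h (φ (y, u)) ∂ν = ∫ v, R (y, v) * h v ∂μ₂ := by
  refine ⟨fibrewise_of_condExp μy ν μ₂ hρ hφ hac, fun hfib => ?_⟩
  have hsk : Measurable (fun q : Y × U => (q.1, φ q)) := measurable_fst.prodMk hφ
  refine ae_eq_of_forall_integral_mul_eq (integrable_kernelTransport _ _ hsk hac hρ) hRint fun f hf hC => ?_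
  rw [← weak_kernelTransport_skew μy ν μ₂ hρ hφ hac f hf hC]
  exact weak_of_fibrewise μy ν μ₂ hρ hφ hRint hfib f hf hC

/-- ★★ **(hce) ⟺ (hfib)**, candidate nonnegative and measurable. [cite: Balaban1988Convergent, (3.1) p.264, (2.21) p.258 (SHAPE); Balaban1987RG1, (0.4) p.253] -/
theorem condExp_iff_fibrewise_of_nonneg [StandardBorelSpace V] (μy : Measure Y) [IsFiniteMeasure μy] (ν : Measure U) [IsFiniteMeasure ν] (μ₂ : Measure V)
    [IsFiniteMeasure μ₂]
    {ρ : Y × U → ℝ} (hρ : Integrable ρ (μy.prod ν)) {φ : Y × U → V} (hφ : Measurable φ)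
    (hac : (μy.prod ν).map (fun q : Y × U => (q.1, φ q)) ≪ μy.prod μ₂) {R : Y × V → ℝ} (hR0 : ∀ z, 0 ≤ R z) (hRm : Measurable R) :
    kernelTransport (μy.prod ν) (μy.prod μ₂) (fun q : Y × U => (q.1, φ q)) ρ =ᵐ[μy.prod μ₂] R ↔
    ∀ᵐ y ∂μy, ∀ h : V → ℝ, Measurable h → (∃ C : ℝ, ∀ v, |h v| ≤ C) →
      ∫ u, ρ (y, u) * h (φ (y, u)) ∂ν = ∫ v, R (y, v) * h v ∂μ₂ := by
  refine ⟨fibrewise_of_condExp μy ν μ₂ hρ hφ hac, fun hfib => ?_⟩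
  exact (condExp_iff_fibrewise μy ν μ₂ hρ hφ hac (integrable_candidate_of_fibrewise μy ν μ₂ hρ hφ hR0 hRm hfib)).2 hfib

end Generic

/-! ## §2  Record letters: the fine field glued along a bond partition `sV ∕ sVᶜ`, the new coarse variables off `sV'` -/

section Record

open Node00 hiding SU
open Node00.Tk T4Continuum BlockAveraging
open B10Eq42TorusConstraint (bondsIn)
open B10Eq38TorusDomains (toFine)
open BlockAveragingHaarAC (centralBond centralBond_injective isLocal_avgFun)
open _root_.Function (update update_self update_of_ne)
open ExpMeanLog (expMeanLogSU)

variable (F : T4Family) (N : ℕ) [NeZero N]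

omit [NeZero N] in
/-- The glue reads the second component off `sV`. [folklore] -/
private theorem glue_apply_of_not_mem {K j : ℕ} [DecidableEq (PBond (F.P K) j)] (sV : Finset (PBond (F.P K) j))
    (q : (↥sV → SU N) × ({b : PBond (F.P K) j // b ∉ sV} → SU N)) {b : PBond (F.P K) j} (hb : b ∉ sV) :
    (MeasurableEquiv.piEquivPiSubtypeProd (fun _ : PBond (F.P K) j => SU N) (· ∈ sV)).symm q b = q.2 ⟨b, hb⟩ := by
  show (if h : b ∈ sV then q.1 ⟨b, h⟩ else q.2 ⟨b, h⟩) = q.2 ⟨b, hb⟩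
  rw [dif_neg hb]

omit [NeZero N] in
/-- The glue reads the first component on `sV`. [folklore] -/
private theorem glue_apply_of_mem {K j : ℕ} [DecidableEq (PBond (F.P K) j)] (sV : Finset (PBond (F.P K) j))
    (q : (↥sV → SU N) × ({b : PBond (F.P K) j // b ∉ sV} → SU N)) {b : PBond (F.P K) j} (hb : b ∈ sV) :
    (MeasurableEquiv.piEquivPiSubtypeProd (fun _ : PBond (F.P K) j => SU N) (· ∈ sV)).symm q b = q.1 ⟨b, hb⟩ := by
  show (if h : b ∈ sV then q.1 ⟨b, h⟩ else q.2 ⟨b, h⟩) = q.1 ⟨b, hb⟩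
  rw [dif_pos hb]

omit [NeZero N] in
/-- Updating an off-`sV` coordinate of the datum updates that bond of the glued field (dag-n11-e p612977's private plumbing, restated). [folklore] -/
private theorem glue_update_snd {K j : ℕ} [DecidableEq (PBond (F.P K) j)] (sV : Finset (PBond (F.P K) j))
    (y : ↥sV → SU N) (r : {b : PBond (F.P K) j // b ∉ sV} → SU N) (b : {b : PBond (F.P K) j // b ∉ sV}) (g : SU N) :
    (MeasurableEquiv.piEquivPiSubtypeProd (fun _ : PBond (F.P K) j => SU N) (· ∈ sV)).symm (y, update r b g) =
      update ((MeasurableEquiv.piEquivPiSubtypeProd (fun _ : PBond (F.P K) j => SU N) (· ∈ sV)).symm (y, r)) b g := by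
  funext i
  by_cases hib : i = (b : PBond (F.P K) j)
  · subst hib
    rw [update_self, glue_apply_of_not_mem F N sV _ b.2]
    simp only [Subtype.coe_eta, update_self]
  · rw [update_of_ne hib]
    by_cases hi : i ∈ sV
    · rw [glue_apply_of_mem F N sV _ hi, glue_apply_of_mem F N sV _ hi]
    · have hne : (⟨i, hi⟩ : {b : PBond (F.P K) j // b ∉ sV}) ≠ b := fun h => hib (congrArg Subtype.val h)
      rw [glue_apply_of_not_mem F N sV _ hi, glue_apply_of_not_mem F N sV _ hi]
      exact update_of_ne hne _ _

/-- ★ **FIBRE ABSOLUTE CONTINUITY FOR EVERY FROZEN RETAINED CONFIGURATION.**  For a fine region `Y` saturated at level `k+1`, `sV ⊆ B_k(Y)` and `B_{k+1}(Y) ⊆ sV'`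
(so the private coordinate `β(c)` — the central crossing bond — of a coarse bond `c ∉ sV'` is NOT in `sV`), and EVERY datum `y` on `sV`: the fibre map
`u ↦ (c ↦ Ū(e(y,u))(c))_{c ∉ sV'}` pushes `⊗_{b ∉ sV} dU(b)` to a measure `≪ ⊗_{c ∉ sV'} dV(c)` — the triangular push-forward theorem
(`T4TriangularPushforward.map_pi_absolutelyContinuous_pi`) in the private coordinates, locality from `isLocal_avgFun`, one-variable laws from the fibre law of the tree's averaging
(`map_haar_avOfRecord_update_centralBond_absolutelyContinuous`).  The frozen-`y` strengthening of p612977's joint `map_prod_avOfRecord_glue_skew_absolutelyContinuous`.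
[cite: Balaban1987RG1, (0.4) p.253; Balaban1988Convergent, (2.21) p.258, (3.1) p.264 (bookkeeping)] -/
theorem map_pi_avOfRecord_glue_fibre_absolutelyContinuous (K k : ℕ) [DecidableEq (PBond (F.P K) k)] [DecidableEq (PBond (F.P K) (k + 1))]
    (hk : k + 1 ≤ (F.P K).m + (F.P K).K)
    {Y : Set (Site (F.P K) 0)} (hY : ∀ x : Site (F.P K) k, toFine k x ∈ Y ↔ toFine (k + 1) (blockOf x) ∈ Y)
    {sV : Finset (PBond (F.P K) k)} (hsV : ∀ b : PBond (F.P K) k, b ∈ sV → b ∈ bondsIn k Y)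
    {sV' : Finset (PBond (F.P K) (k + 1))} (hsV' : ∀ c : PBond (F.P K) (k + 1), c ∈ bondsIn (k + 1) Y → c ∈ sV')
    (y : ↥sV → SU N) :
    (Measure.pi fun _ : {b : PBond (F.P K) k // b ∉ sV} => (HaarData.haar : Measure (SU N))).map
        (fun u => fun c : {c : PBond (F.P K) (k + 1) // c ∉ sV'} =>
          (avOfRecord F N K k).avg ((MeasurableEquiv.piEquivPiSubtypeProd (fun _ : PBond (F.P K) k => SU N) (· ∈ sV)).symm (y, u)) c) ≪
      Measure.pi fun _ : {c : PBond (F.P K) (k + 1) // c ∉ sV'} => (HaarData.haar : Measure (SU N)) := by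
  set eβ := (MeasurableEquiv.piEquivPiSubtypeProd (fun _ : PBond (F.P K) k => SU N) (· ∈ sV)).symm with heβ
  have hnot : ∀ c : {c : PBond (F.P K) (k + 1) // c ∉ sV'}, centralBond (c : PBond (F.P K) (k + 1)) ∉ sV :=
    fun c h => c.2 (hsV' _ ((centralBond_mem_bondsIn_iff hk hY _).1 (hsV _ h)))
  let β : {c : PBond (F.P K) (k + 1) // c ∉ sV'} → {b : PBond (F.P K) k // b ∉ sV} :=
    fun c => ⟨centralBond (c : PBond (F.P K) (k + 1)), hnot c⟩
  have hβ : Function.Injective β := fun c c' h =>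
    Subtype.ext (centralBond_injective hk (congrArg Subtype.val h : (β c : PBond (F.P K) k) = β c'))
  have hloc : T4TriangularPushforward.IsLocal β
      (fun (u : {b : PBond (F.P K) k // b ∉ sV} → SU N) (c : {c : PBond (F.P K) (k + 1) // c ∉ sV'}) => (avOfRecord F N K k).avg (eβ (y, u)) c) := by
    intro u c g c' hc'
    show (avOfRecord F N K k).avg (eβ (y, update u (β c) g)) c' = (avOfRecord F N K k).avg (eβ (y, u)) c'
    rw [heβ, glue_update_snd F N sV y u (β c) g, avOfRecord_avg]
    exact isLocal_avgFun hk expMeanLogSU _ _ g _ fun h => hc' (Subtype.ext h)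
  have hmeas : Measurable (fun (u : {b : PBond (F.P K) k // b ∉ sV} → SU N) (c : {c : PBond (F.P K) (k + 1) // c ∉ sV'}) =>
      (avOfRecord F N K k).avg (eβ (y, u)) c) :=
    (measurable_avOfRecord_glue_rest F N K k sV sV').comp measurable_prodMk_left
  refine T4TriangularPushforward.map_pi_absolutelyContinuous_pi (HaarData.haar : Measure (SU N)) hloc hβ hmeas fun u c => ?_
  have hfun : (fun g => (fun (u : {b : PBond (F.P K) k // b ∉ sV} → SU N) (c : {c : PBond (F.P K) (k + 1) // c ∉ sV'}) =>
        (avOfRecord F N K k).avg (eβ (y, u)) c) (update u (β c) g) c) =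
      fun g => (avOfRecord F N K k).avg (update (eβ (y, u)) (centralBond (c : PBond (F.P K) (k + 1))) g) c := by
    funext g
    show (avOfRecord F N K k).avg (eβ (y, update u (β c) g)) c = _
    rw [heβ, glue_update_snd F N sV y u (β c) g]
  rw [hfun]
  exact map_haar_avOfRecord_update_centralBond_absolutelyContinuous F N K k hk (eβ (y, u)) c

/-- ★★★ **AT THE RECORD: THE FROZEN-`y` SECTIONS OF def-T's SKEW CONDITIONAL EXPECTATION ARE THE FIBRE TRANSPORTS.**  For ANY `dU`-integrable fine density `ρ`,
`Y` saturated, `sV ⊆ B_k(Y)`, `B_{k+1}(Y) ⊆ sV'`: for `(⊗_{sV} dU)`-a.e. retained configuration `y`,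
`(v ↦ kernelTransport μ_in μ_out skew (ρ ∘ e) (y, v)) =ᵐ[⊗_{c ∉ sV'} dV] kernelTransport (⊗_{b ∉ sV} dU) (⊗_{c ∉ sV'} dV) (u ↦ (Ū(e(y,u))(c))_{c ∉ sV'}) (u ↦ ρ(e(y,u)))`,
`μ_in = (⊗_{sV} dU) ⊗ (⊗_{sVᶜ} dU)`, `μ_out = (⊗_{sV} dU) ⊗ (⊗_{sV'ᶜ} dV)`, `skew q = (q.1, (Ū(e q)(c))_{c ∉ sV'})` — the currency in which print freezes `U|_{B_k(Ω^c_{k+1})}` and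
integrates the variables over `Ω_{k+1}` ([III] (3.10)–(3.25)); on each fibre the transport is a def-T `kernelTransport` of a fine density along an averaging-type map, where the
gauge-fixing laws of `Node00/TransportOfRecordGaugeFixing*` act. [cite: Balaban1988Convergent, (3.1) p.264, (3.10)–(3.14) pp.266–267, (3.23)–(3.25) p.270; Balaban1987RG1, (0.4) p.253, §2 p.267] -/
theorem ae_condExp_section_ae_eq_fibreTransport_at_record (K k : ℕ) {hdec : DecidableEq (PBond (F.P K) k)} {hdec' : DecidableEq (PBond (F.P K) (k + 1))}
    (hk : k + 1 ≤ (F.P K).m + (F.P K).K)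
    {Y : Set (Site (F.P K) 0)} (hY : ∀ x : Site (F.P K) k, toFine k x ∈ Y ↔ toFine (k + 1) (blockOf x) ∈ Y)
    {sV : Finset (PBond (F.P K) k)} (hsV : ∀ b : PBond (F.P K) k, b ∈ sV → b ∈ bondsIn k Y)
    {sV' : Finset (PBond (F.P K) (k + 1))} (hsV' : ∀ c : PBond (F.P K) (k + 1), c ∈ bondsIn (k + 1) Y → c ∈ sV')
    {ρ : GaugeField (F.P K) k (SU N) → ℝ} (hρ : Integrable ρ (fieldMeasure (F.P K) k (SU N))) :
    ∀ᵐ y ∂(Measure.pi fun _ : ↥sV => (HaarData.haar : Measure (SU N))),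
      (fun v => kernelTransport
          ((Measure.pi fun _ : ↥sV => (HaarData.haar : Measure (SU N))).prod
            (Measure.pi fun _ : {b : PBond (F.P K) k // b ∉ sV} => (HaarData.haar : Measure (SU N))))
          ((Measure.pi fun _ : ↥sV => (HaarData.haar : Measure (SU N))).prod
            (Measure.pi fun _ : {c : PBond (F.P K) (k + 1) // c ∉ sV'} => (HaarData.haar : Measure (SU N))))
          (fun q => (q.1, fun c : {c : PBond (F.P K) (k + 1) // c ∉ sV'} =>
            (avOfRecord F N K k).avg ((MeasurableEquiv.piEquivPiSubtypeProd (fun _ : PBond (F.P K) k => SU N) (· ∈ sV)).symm q) c))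
          (ρ ∘ ⇑(MeasurableEquiv.piEquivPiSubtypeProd (fun _ : PBond (F.P K) k => SU N) (· ∈ sV)).symm) (y, v)) =ᵐ[
        Measure.pi fun _ : {c : PBond (F.P K) (k + 1) // c ∉ sV'} => (HaarData.haar : Measure (SU N))]
      kernelTransport (Measure.pi fun _ : {b : PBond (F.P K) k // b ∉ sV} => (HaarData.haar : Measure (SU N)))
        (Measure.pi fun _ : {c : PBond (F.P K) (k + 1) // c ∉ sV'} => (HaarData.haar : Measure (SU N)))
        (fun u => fun c : {c : PBond (F.P K) (k + 1) // c ∉ sV'} =>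
          (avOfRecord F N K k).avg ((MeasurableEquiv.piEquivPiSubtypeProd (fun _ : PBond (F.P K) k => SU N) (· ∈ sV)).symm (y, u)) c)
        (fun u => ρ ((MeasurableEquiv.piEquivPiSubtypeProd (fun _ : PBond (F.P K) k => SU N) (· ∈ sV)).symm (y, u))) := by
  have hpres := measurePreserving_piEquivPiSubtypeProd_symm_fieldMeasure (G := SU N) (P := F.P K) (j := k) sV
  have hρ' := (hpres.integrable_comp hρ.aestronglyMeasurable).mpr hρ
  exact ae_kernelTransport_skew_section_ae_eq_fibre _ _ _ hρ' (measurable_avOfRecord_glue_rest F N K k sV sV')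
    (map_pi_avOfRecord_glue_fibre_absolutelyContinuous F N K k hk hY hsV hsV')

/-- ★★★ **AT THE RECORD: (hce) ⟹ (hfib)** — the converse of dag-n11-d's `condExp_identity_of_fibrewise[_of_nonneg]` at ANY finite bond sets `sV`, `sV'` with the skew map's
joint absolute continuity DISPLAYED (`hac`; a theorem at saturated letters, next): if def-T's skew conditional expectation of `ρ ∘ e` IS `R` a.e., then for a.e. retained
configuration `y` and EVERY bounded measurable `h` of the new variables alone, `∫ ρ(e(y,u))·h((Ū(e(y,u))(c))_{c∉sV'}) d(⊗_{sVᶜ}dU) = ∫ R(y,v)·h(v) d(⊗_{sV'ᶜ}dV)`.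
[cite: Balaban1988Convergent, (3.1) p.264, (3.10)–(3.14) pp.266–267, (3.23)–(3.25) p.270; Balaban1987RG1, (0.4) p.253, §2 p.267] -/
theorem fibrewise_of_condExp_at_record (K k : ℕ) {hdec : DecidableEq (PBond (F.P K) k)} {hdec' : DecidableEq (PBond (F.P K) (k + 1))}
    (sV : Finset (PBond (F.P K) k)) (sV' : Finset (PBond (F.P K) (k + 1)))
    {ρ : GaugeField (F.P K) k (SU N) → ℝ} (hρ : Integrable ρ (fieldMeasure (F.P K) k (SU N)))
    (hac : ((Measure.pi fun _ : ↥sV => (HaarData.haar : Measure (SU N))).prod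
        (Measure.pi fun _ : {b : PBond (F.P K) k // b ∉ sV} => (HaarData.haar : Measure (SU N)))).map
        (fun q => (q.1, fun c : {c : PBond (F.P K) (k + 1) // c ∉ sV'} =>
          (avOfRecord F N K k).avg ((MeasurableEquiv.piEquivPiSubtypeProd (fun _ : PBond (F.P K) k => SU N) (· ∈ sV)).symm q) c)) ≪
      (Measure.pi fun _ : ↥sV => (HaarData.haar : Measure (SU N))).prod
        (Measure.pi fun _ : {c : PBond (F.P K) (k + 1) // c ∉ sV'} => (HaarData.haar : Measure (SU N))))
    {R : (↥sV → SU N) × ({c : PBond (F.P K) (k + 1) // c ∉ sV'} → SU N) → ℝ}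
    (hce : kernelTransport
        ((Measure.pi fun _ : ↥sV => (HaarData.haar : Measure (SU N))).prod
          (Measure.pi fun _ : {b : PBond (F.P K) k // b ∉ sV} => (HaarData.haar : Measure (SU N))))
        ((Measure.pi fun _ : ↥sV => (HaarData.haar : Measure (SU N))).prod
          (Measure.pi fun _ : {c : PBond (F.P K) (k + 1) // c ∉ sV'} => (HaarData.haar : Measure (SU N))))
        (fun q => (q.1, fun c : {c : PBond (F.P K) (k + 1) // c ∉ sV'} =>
          (avOfRecord F N K k).avg ((MeasurableEquiv.piEquivPiSubtypeProd (fun _ : PBond (F.P K) k => SU N) (· ∈ sV)).symm q) c))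
        (ρ ∘ ⇑(MeasurableEquiv.piEquivPiSubtypeProd (fun _ : PBond (F.P K) k => SU N) (· ∈ sV)).symm)
      =ᵐ[(Measure.pi fun _ : ↥sV => (HaarData.haar : Measure (SU N))).prod
          (Measure.pi fun _ : {c : PBond (F.P K) (k + 1) // c ∉ sV'} => (HaarData.haar : Measure (SU N)))] R) :
    ∀ᵐ y ∂(Measure.pi fun _ : ↥sV => (HaarData.haar : Measure (SU N))),
      ∀ h : ({c : PBond (F.P K) (k + 1) // c ∉ sV'} → SU N) → ℝ, Measurable h → (∃ C : ℝ, ∀ v, |h v| ≤ C) →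
        ∫ u, ρ ((MeasurableEquiv.piEquivPiSubtypeProd (fun _ : PBond (F.P K) k => SU N) (· ∈ sV)).symm (y, u)) *
            h (fun c : {c : PBond (F.P K) (k + 1) // c ∉ sV'} =>
              (avOfRecord F N K k).avg ((MeasurableEquiv.piEquivPiSubtypeProd (fun _ : PBond (F.P K) k => SU N) (· ∈ sV)).symm (y, u)) c)
          ∂(Measure.pi fun _ : {b : PBond (F.P K) k // b ∉ sV} => (HaarData.haar : Measure (SU N))) =
        ∫ v, R (y, v) * h v ∂(Measure.pi fun _ : {c : PBond (F.P K) (k + 1) // c ∉ sV'} => (HaarData.haar : Measure (SU N))) := by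
  have hpres := measurePreserving_piEquivPiSubtypeProd_symm_fieldMeasure (G := SU N) (P := F.P K) (j := k) sV
  have hρ' := (hpres.integrable_comp hρ.aestronglyMeasurable).mpr hρ
  exact fibrewise_of_condExp _ _ _ hρ' (measurable_avOfRecord_glue_rest F N K k sV sV') hac hce

/-- ★★★ **AT THE RECORD: (hce) ⟺ (hfib)**, candidate integrable, joint absolute continuity displayed. [cite: Balaban1988Convergent, (3.1) p.264, (2.21) p.258, (3.23)–(3.25) p.270; Balaban1987RG1, (0.4) p.253] -/
theorem condExp_iff_fibrewise_at_record (K k : ℕ) {hdec : DecidableEq (PBond (F.P K) k)} {hdec' : DecidableEq (PBond (F.P K) (k + 1))}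
    (sV : Finset (PBond (F.P K) k)) (sV' : Finset (PBond (F.P K) (k + 1)))
    {ρ : GaugeField (F.P K) k (SU N) → ℝ} (hρ : Integrable ρ (fieldMeasure (F.P K) k (SU N)))
    (hac : ((Measure.pi fun _ : ↥sV => (HaarData.haar : Measure (SU N))).prod
        (Measure.pi fun _ : {b : PBond (F.P K) k // b ∉ sV} => (HaarData.haar : Measure (SU N)))).map
        (fun q => (q.1, fun c : {c : PBond (F.P K) (k + 1) // c ∉ sV'} =>
          (avOfRecord F N K k).avg ((MeasurableEquiv.piEquivPiSubtypeProd (fun _ : PBond (F.P K) k => SU N) (· ∈ sV)).symm q) c)) ≪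
      (Measure.pi fun _ : ↥sV => (HaarData.haar : Measure (SU N))).prod
        (Measure.pi fun _ : {c : PBond (F.P K) (k + 1) // c ∉ sV'} => (HaarData.haar : Measure (SU N))))
    {R : (↥sV → SU N) × ({c : PBond (F.P K) (k + 1) // c ∉ sV'} → SU N) → ℝ}
    (hRint : Integrable R ((Measure.pi fun _ : ↥sV => (HaarData.haar : Measure (SU N))).prod
      (Measure.pi fun _ : {c : PBond (F.P K) (k + 1) // c ∉ sV'} => (HaarData.haar : Measure (SU N))))) :
    kernelTransport
        ((Measure.pi fun _ : ↥sV => (HaarData.haar : Measure (SU N))).prod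
          (Measure.pi fun _ : {b : PBond (F.P K) k // b ∉ sV} => (HaarData.haar : Measure (SU N))))
        ((Measure.pi fun _ : ↥sV => (HaarData.haar : Measure (SU N))).prod
          (Measure.pi fun _ : {c : PBond (F.P K) (k + 1) // c ∉ sV'} => (HaarData.haar : Measure (SU N))))
        (fun q => (q.1, fun c : {c : PBond (F.P K) (k + 1) // c ∉ sV'} =>
          (avOfRecord F N K k).avg ((MeasurableEquiv.piEquivPiSubtypeProd (fun _ : PBond (F.P K) k => SU N) (· ∈ sV)).symm q) c))
        (ρ ∘ ⇑(MeasurableEquiv.piEquivPiSubtypeProd (fun _ : PBond (F.P K) k => SU N) (· ∈ sV)).symm)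
      =ᵐ[(Measure.pi fun _ : ↥sV => (HaarData.haar : Measure (SU N))).prod
          (Measure.pi fun _ : {c : PBond (F.P K) (k + 1) // c ∉ sV'} => (HaarData.haar : Measure (SU N)))] R ↔
    ∀ᵐ y ∂(Measure.pi fun _ : ↥sV => (HaarData.haar : Measure (SU N))),
      ∀ h : ({c : PBond (F.P K) (k + 1) // c ∉ sV'} → SU N) → ℝ, Measurable h → (∃ C : ℝ, ∀ v, |h v| ≤ C) →
        ∫ u, ρ ((MeasurableEquiv.piEquivPiSubtypeProd (fun _ : PBond (F.P K) k => SU N) (· ∈ sV)).symm (y, u)) *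
            h (fun c : {c : PBond (F.P K) (k + 1) // c ∉ sV'} =>
              (avOfRecord F N K k).avg ((MeasurableEquiv.piEquivPiSubtypeProd (fun _ : PBond (F.P K) k => SU N) (· ∈ sV)).symm (y, u)) c)
          ∂(Measure.pi fun _ : {b : PBond (F.P K) k // b ∉ sV} => (HaarData.haar : Measure (SU N))) =
        ∫ v, R (y, v) * h v ∂(Measure.pi fun _ : {c : PBond (F.P K) (k + 1) // c ∉ sV'} => (HaarData.haar : Measure (SU N))) := by
  have hpres := measurePreserving_piEquivPiSubtypeProd_symm_fieldMeasure (G := SU N) (P := F.P K) (j := k) sV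
  have hρ' := (hpres.integrable_comp hρ.aestronglyMeasurable).mpr hρ
  exact condExp_iff_fibrewise _ _ _ hρ' (measurable_avOfRecord_glue_rest F N K k sV sV') hac hRint

end Record

end Summit.QuantumFields.YangMills.Theorems.BalabanUVNodesN11CondExpFibreSections

end
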